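import Literature.NumberTheory.GaloisRepresentations.LiftingObstructionParabolic
import HarnessLib

/-!
# Lifts through a square-zero extension form a torsor under `1`-cocycles

Topic `Literature/NumberTheory/GaloisRepresentations`.  Continuation of `LiftingObstruction.lean`
(`φ : B ↠ A` with square-zero kernel `I`, `ρ : G → GL_n(A)`, `s` a set-theoretic lift of
`GL_n(φ)`), the SECOND half of Mazur's §1.6: once a lift exists, the set of lifts is a principal
homogeneous space under `Z¹(G, M_n(I)) = Z¹(G, ad ρ ⊗ I)` and strict equivalence classes of
lifts under `H¹`:

* `liftDiff ρ₁ ρ₂ σ = ρ₂(σ) ρ₁(σ)⁻¹ − 1 ∈ M_n(I)` for two lifts `ρ₁, ρ₂` of `ρ`, a `1`-cocycle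
  (`liftDiff_cocycle`: `d(στ) = d(σ) + σ·d(τ)`, tree convention `mem_contOneCocycles_iff`), and
  `ρ₂(σ) = (1 + d(σ)) ρ₁(σ)` (`eq_unitOfKer_liftDiff_mul`);
* `twistLift` — conversely `σ ↦ (1 + d(σ)) ρ₁(σ)` is a lift for every `M_n(I)`-valued
  `1`-cocycle `d`, with `liftDiff ρ₁ (twistLift d) = d`;
* `liftDiff_conj` — conjugating a lift by `1 + X`, `X ∈ M_n(I)`, changes it by the coboundary
  `σ ↦ X − σ·X`;
* the parabolic refinement `conj_mem_parabolicGL_of_liftDiff_eq` — if `ρ_P` is a `P_b(B)`-valued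
  lift (of a `P_b(A)`-valued `ρ`) and the difference cocycle of a second lift `ρ₂` is
  `𝔭_b(I)`-valued up to a coboundary, `d = e + (X − σ·X)`, then `(1 + X)⁻¹ ρ₂ (1 + X)` is
  `P_b(B)`-valued: **a lift is conjugate, by an element of `1 + M_n(I)`, into the parabolic iff its
  class relative to a parabolic lift lies in the image of `H¹(G, 𝔭_b ⊗ I) → H¹(G, ad ⊗ I)`** — the
  "secondary" (local-condition) obstruction of deformation problems with local conditions
  (Mazur 1989, §1.6–1.7; Böckle 2007, §5, proof of Thm. 5.2).

Everything is proved at cochain level (no topology); no named facts.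

## References

* B. Mazur, *Deforming Galois representations*, in Galois groups over `ℚ`, MSRI Publ. 16
  (1989), §1.6 (Prop. 2 and the discussion of `H¹` as tangent space), §1.7. [cite: Mazur1989Deforming, §1.6 Prop. 2]
* G. Böckle, *Presentations of universal deformation rings*, LMS LNS 320 (2007), §5. [cite: Bockle2007Presentations, Theorem 5.2]
-/

noncomputable section

namespace Literature.NumberTheory.GaloisRepresentations

namespace LiftingObstruction

open Matrix

variable {n : Type*} [Fintype n] [DecidableEq n] {A B : Type*} [CommRing A] [CommRing B]
  {φ : B →+* A} (hI : ∀ x ∈ RingHom.ker φ, ∀ y ∈ RingHom.ker φ, x * y = 0)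
  {G : Type*} [Group G] {s : GL n A → GL n B}
  (hs : ∀ g, Matrix.GeneralLinearGroup.map φ (s g) = g) (ρ : G →* GL n A)

/-! ## 1. The difference cocycle of two lifts -/

/-- The **difference cocycle** `d(σ) = ρ₂(σ) ρ₁(σ)⁻¹ − 1` of two lifts of the same representation.
[cite: Mazur1989Deforming, §1.6 Prop. 2] -/
def liftDiff (ρ₁ ρ₂ : G →* GL n B) (σ : G) : Matrix n n B :=
  ((ρ₂ σ * (ρ₁ σ)⁻¹ : GL n B) : Matrix n n B) - 1

variable {ρ} {ρ₁ ρ₂ : G →* GL n B}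
  (h₁ : ∀ σ, Matrix.GeneralLinearGroup.map φ (ρ₁ σ) = ρ σ)
  (h₂ : ∀ σ, Matrix.GeneralLinearGroup.map φ (ρ₂ σ) = ρ σ)

include h₁ h₂ in
/-- `ρ₂(σ) ρ₁(σ)⁻¹ ↦ 1`. [folklore] -/
theorem map_mul_inv_eq_one (σ : G) :
    Matrix.GeneralLinearGroup.map φ (ρ₂ σ * (ρ₁ σ)⁻¹) = 1 := by
  rw [map_mul, map_inv, h₁, h₂, mul_inv_cancel]

include h₁ h₂ in
/-- The difference cocycle is `M_n(I)`-valued. [cite: Mazur1989Deforming, §1.6 Prop. 2] -/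
theorem liftDiff_mem (σ : G) : liftDiff ρ₁ ρ₂ σ ∈ kerMatrix φ :=
  val_sub_one_mem _ (map_mul_inv_eq_one h₁ h₂ σ)

omit hI in
/-- `ρ₂(σ) = (1 + d(σ)) ρ₁(σ)`. [folklore] -/
theorem coe_eq_one_add_liftDiff_mul (ρ₁ ρ₂ : G →* GL n B) (σ : G) :
    (ρ₂ σ : Matrix n n B) = (1 + liftDiff ρ₁ ρ₂ σ) * (ρ₁ σ : Matrix n n B) := by
  rw [liftDiff, add_sub_cancel, ← Units.val_mul, inv_mul_cancel_right]

include hI h₁ h₂ in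
/-- `ρ₂(σ) = unitOfKer (d σ) · ρ₁(σ)` in `GL_n(B)`. [folklore] -/
theorem eq_unitOfKer_liftDiff_mul (σ : G) :
    ρ₂ σ = unitOfKer hI (liftDiff ρ₁ ρ₂ σ) (liftDiff_mem h₁ h₂ σ) * ρ₁ σ :=
  Units.ext (by rw [Units.val_mul, val_unitOfKer]; exact coe_eq_one_add_liftDiff_mul ρ₁ ρ₂ σ)

omit hI in
/-- `P D P⁻¹ − 1 = P (D − 1) P⁻¹`. [folklore] -/
theorem val_conj_sub_one' (P D : GL n B) :
    ((P * D * P⁻¹ : GL n B) : Matrix n n B) - 1 =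
      (P : Matrix n n B) * ((D : Matrix n n B) - 1) * ((P⁻¹ : GL n B) : Matrix n n B) := by
  have hPP : (P : Matrix n n B) * ((P⁻¹ : GL n B) : Matrix n n B) = 1 := by
    rw [← Units.val_mul, mul_inv_cancel, Units.val_one]
  rw [Units.val_mul, Units.val_mul, mul_sub, sub_mul, mul_one, hPP]

include hI hs h₁ h₂ in
/-- **The difference of two lifts is a `1`-cocycle**: `d(στ) = d(σ) + s(ρσ) d(τ) s(ρσ)⁻¹`
(conjugation through any lift of `ρ σ`, e.g. `ρ₁ σ`, gives the same action on `M_n(I)`).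
[cite: Mazur1989Deforming, §1.6 Prop. 2] -/
theorem liftDiff_cocycle (σ τ : G) :
    liftDiff ρ₁ ρ₂ (σ * τ) =
      liftDiff ρ₁ ρ₂ σ +
        (s (ρ σ) : Matrix n n B) * liftDiff ρ₁ ρ₂ τ * ((s (ρ σ))⁻¹ : GL n B) := by
  have hD : ∀ σ, Matrix.GeneralLinearGroup.map φ (ρ₂ σ * (ρ₁ σ)⁻¹) = 1 :=
    map_mul_inv_eq_one h₁ h₂
  -- `D(στ) = D(σ) · (ρ₁σ D(τ) ρ₁σ⁻¹)`
  have hmul : ρ₂ (σ * τ) * (ρ₁ (σ * τ))⁻¹ =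
      (ρ₂ σ * (ρ₁ σ)⁻¹) * (ρ₁ σ * (ρ₂ τ * (ρ₁ τ)⁻¹) * (ρ₁ σ)⁻¹) := by
    rw [map_mul, map_mul]
    group
  have hconj : Matrix.GeneralLinearGroup.map φ (ρ₁ σ * (ρ₂ τ * (ρ₁ τ)⁻¹) * (ρ₁ σ)⁻¹) = 1 := by
    rw [map_mul, map_mul, hD, mul_one, map_inv, mul_inv_cancel]
  unfold liftDiff
  rw [hmul, val_mul_sub_one hI _ _ (hD σ) hconj, val_conj_sub_one',
    conj_eq_of_map_eq hI (ρ₁ σ) (s (ρ σ)) (by rw [h₁, hs]) (val_sub_one_mem _ (hD τ))]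

omit hI in
/-- `liftDiff ρ₁ ρ₁ = 0`. [folklore] -/
@[simp] theorem liftDiff_self (ρ₁ : G →* GL n B) (σ : G) : liftDiff ρ₁ ρ₁ σ = 0 := by
  rw [liftDiff, mul_inv_cancel, Units.val_one, sub_self]

include hI h₁ h₂ in
/-- **Transitivity**: `liftDiff ρ₂ ρ₃ = liftDiff ρ₁ ρ₃ − liftDiff ρ₁ ρ₂`. [folklore] -/
theorem liftDiff_eq_sub {ρ₃ : G →* GL n B}
    (h₃ : ∀ σ, Matrix.GeneralLinearGroup.map φ (ρ₃ σ) = ρ σ) (σ : G) :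
    liftDiff ρ₂ ρ₃ σ = liftDiff ρ₁ ρ₃ σ - liftDiff ρ₁ ρ₂ σ := by
  have h13 : ρ₃ σ * (ρ₁ σ)⁻¹ = (ρ₃ σ * (ρ₂ σ)⁻¹) * (ρ₂ σ * (ρ₁ σ)⁻¹) := by group
  have e : liftDiff ρ₁ ρ₃ σ = liftDiff ρ₂ ρ₃ σ + liftDiff ρ₁ ρ₂ σ := by
    unfold liftDiff
    rw [h13, val_mul_sub_one hI _ _ (map_mul_inv_eq_one h₂ h₃ σ) (map_mul_inv_eq_one h₁ h₂ σ)]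
  rw [e, add_sub_cancel_right]

include hI h₁ h₂ in
/-- Two lifts with the same difference cocycle (from a common lift) are equal. [folklore] -/
theorem eq_of_liftDiff_eq {ρ₃ : G →* GL n B}
    (h₃ : ∀ σ, Matrix.GeneralLinearGroup.map φ (ρ₃ σ) = ρ σ)
    (h : ∀ σ, liftDiff ρ₁ ρ₂ σ = liftDiff ρ₁ ρ₃ σ) : ρ₂ = ρ₃ := by
  refine MonoidHom.ext fun σ => ?_
  rw [eq_unitOfKer_liftDiff_mul hI h₁ h₂ σ, eq_unitOfKer_liftDiff_mul hI h₁ h₃ σ]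
  congr 1
  exact Units.ext (by simp [h σ])

/-! ## 2. Twisting a lift by a `1`-cocycle -/

include hs in
/-- **The twist of a lift by a `1`-cocycle**: for an `M_n(I)`-valued `d` with
`d(στ) = d(σ) + σ·d(τ)`, `σ ↦ (1 + d(σ)) ρ₁(σ)` is again a homomorphism lifting `ρ`.
[cite: Mazur1989Deforming, §1.6 Prop. 2] -/
def twistLift (ρ₁ : G →* GL n B) (h₁ : ∀ σ, Matrix.GeneralLinearGroup.map φ (ρ₁ σ) = ρ σ)
    (d : G → Matrix n n B) (hd : ∀ σ, d σ ∈ kerMatrix φ)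
    (hcoc : ∀ σ τ, d (σ * τ) = d σ + (s (ρ σ) : Matrix n n B) * d τ * ((s (ρ σ))⁻¹ : GL n B)) :
    G →* GL n B :=
  MonoidHom.mk' (fun σ => unitOfKer hI (d σ) (hd σ) * ρ₁ σ) fun σ τ => by
    have hmap : ∀ σ, Matrix.GeneralLinearGroup.map φ (unitOfKer hI (d σ) (hd σ)) = 1 :=
      fun σ => map_unitOfKer hI _ _
    -- compare `δ` of the kernel parts: `1 + d(στ) = (1 + dσ)(ρ₁σ (1 + dτ) ρ₁σ⁻¹)`
    have hker : unitOfKer hI (d (σ * τ)) (hd (σ * τ)) =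
        unitOfKer hI (d σ) (hd σ) * (ρ₁ σ * unitOfKer hI (d τ) (hd τ) * (ρ₁ σ)⁻¹) := by
      have hconj : Matrix.GeneralLinearGroup.map φ
          (ρ₁ σ * unitOfKer hI (d τ) (hd τ) * (ρ₁ σ)⁻¹) = 1 := by
        rw [map_mul, map_mul, hmap, mul_one, map_inv, mul_inv_cancel]
      refine Units.ext (sub_left_injective (b := (1 : Matrix n n B)) ?_)
      change ((unitOfKer hI (d (σ * τ)) (hd (σ * τ)) : GL n B) : Matrix n n B) - 1 =
        ((unitOfKer hI (d σ) (hd σ) * (ρ₁ σ * unitOfKer hI (d τ) (hd τ) * (ρ₁ σ)⁻¹) : GL n B) :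
          Matrix n n B) - 1
      rw [val_mul_sub_one hI _ _ (hmap σ) hconj, val_conj_sub_one', val_unitOfKer, val_unitOfKer,
        val_unitOfKer, add_sub_cancel_left, add_sub_cancel_left, add_sub_cancel_left,
        conj_eq_of_map_eq hI (ρ₁ σ) (s (ρ σ)) (by rw [h₁, hs]) (hd τ)]
      exact hcoc σ τ
    rw [hker, map_mul]
    group

/-- The formula for `twistLift`. [folklore] -/
theorem twistLift_apply (d : G → Matrix n n B) (hd : ∀ σ, d σ ∈ kerMatrix φ)
    (hcoc : ∀ σ τ, d (σ * τ) = d σ + (s (ρ σ) : Matrix n n B) * d τ * ((s (ρ σ))⁻¹ : GL n B))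
    (σ : G) :
    twistLift hI hs ρ₁ h₁ d hd hcoc σ = unitOfKer hI (d σ) (hd σ) * ρ₁ σ :=
  rfl

include h₁ in
/-- `twistLift` lifts `ρ`. [cite: Mazur1989Deforming, §1.6 Prop. 2] -/
theorem map_twistLift (d : G → Matrix n n B) (hd : ∀ σ, d σ ∈ kerMatrix φ)
    (hcoc : ∀ σ τ, d (σ * τ) = d σ + (s (ρ σ) : Matrix n n B) * d τ * ((s (ρ σ))⁻¹ : GL n B))
    (σ : G) :
    Matrix.GeneralLinearGroup.map φ (twistLift hI hs ρ₁ h₁ d hd hcoc σ) = ρ σ := by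
  rw [twistLift_apply, map_mul, map_unitOfKer, one_mul, h₁]

/-- The difference cocycle of the twist is the twisting cocycle. [folklore] -/
@[simp] theorem liftDiff_twistLift (d : G → Matrix n n B) (hd : ∀ σ, d σ ∈ kerMatrix φ)
    (hcoc : ∀ σ τ, d (σ * τ) = d σ + (s (ρ σ) : Matrix n n B) * d τ * ((s (ρ σ))⁻¹ : GL n B))
    (σ : G) :
    liftDiff ρ₁ (twistLift hI hs ρ₁ h₁ d hd hcoc) σ = d σ := by
  rw [liftDiff, twistLift_apply, mul_inv_cancel_right, val_unitOfKer, add_sub_cancel_left]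

/-! ## 3. Conjugating a lift by `1 + X` -/

/-- The lift `σ ↦ (1 + X) ρ₁(σ) (1 + X)⁻¹`. [folklore] -/
def conjLift (ρ₁ : G →* GL n B) (X : Matrix n n B) (hX : X ∈ kerMatrix φ) : G →* GL n B :=
  (MulAut.conj (unitOfKer hI X hX)).toMonoidHom.comp ρ₁

/-- The formula for `conjLift`. [folklore] -/
@[simp] theorem conjLift_apply (X : Matrix n n B) (hX : X ∈ kerMatrix φ) (σ : G) :
    conjLift hI ρ₁ X hX σ = unitOfKer hI X hX * ρ₁ σ * (unitOfKer hI X hX)⁻¹ :=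
  rfl

include h₁ in
/-- `conjLift` lifts `ρ` (the conjugator maps to `1`). [folklore] -/
theorem map_conjLift (X : Matrix n n B) (hX : X ∈ kerMatrix φ) (σ : G) :
    Matrix.GeneralLinearGroup.map φ (conjLift hI ρ₁ X hX σ) = ρ σ := by
  rw [conjLift_apply, map_mul, map_mul, map_inv, map_unitOfKer, h₁, one_mul, inv_one, mul_one]

omit hI in
/-- The inverse of `unitOfKer X` has matrix `1 − X`. [folklore] -/
@[simp] theorem val_unitOfKer_inv (hI : ∀ x ∈ RingHom.ker φ, ∀ y ∈ RingHom.ker φ, x * y = 0)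
    (X : Matrix n n B) (hX : X ∈ kerMatrix φ) :
    (((unitOfKer hI X hX)⁻¹ : GL n B) : Matrix n n B) = 1 - X :=
  rfl

include hs h₁ in
/-- **Conjugation by `1 + X` changes a lift by a coboundary**:
`liftDiff ρ₁ ((1+X) ρ₁ (1+X)⁻¹)(σ) = X − σ·X`. [cite: Mazur1989Deforming, §1.6 Prop. 2] -/
theorem liftDiff_conjLift (X : Matrix n n B) (hX : X ∈ kerMatrix φ) (σ : G) :
    liftDiff ρ₁ (conjLift hI ρ₁ X hX) σ =
      X - (s (ρ σ) : Matrix n n B) * X * ((s (ρ σ))⁻¹ : GL n B) := by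
  rw [← conj_eq_of_map_eq hI (ρ₁ σ) (s (ρ σ)) (by rw [h₁, hs]) hX]
  rw [liftDiff, conjLift_apply, Units.val_mul, Units.val_mul, Units.val_mul, val_unitOfKer,
    val_unitOfKer_inv]
  have hσX : (ρ₁ σ : Matrix n n B) * X * ((ρ₁ σ)⁻¹ : GL n B) ∈ kerMatrix φ :=
    mul_mem_kerMatrix_right _ (mul_mem_kerMatrix_left _ hX)
  have e : (1 + X) * (ρ₁ σ : Matrix n n B) * (1 - X) * (((ρ₁ σ)⁻¹ : GL n B) : Matrix n n B) - 1 =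
      ((ρ₁ σ : Matrix n n B) * (((ρ₁ σ)⁻¹ : GL n B) : Matrix n n B) - 1) +
        X * ((ρ₁ σ : Matrix n n B) * (((ρ₁ σ)⁻¹ : GL n B) : Matrix n n B)) -
        (ρ₁ σ : Matrix n n B) * X * ((ρ₁ σ)⁻¹ : GL n B) -
        X * ((ρ₁ σ : Matrix n n B) * X * ((ρ₁ σ)⁻¹ : GL n B)) := by
    noncomm_ring
  have hPP : (ρ₁ σ : Matrix n n B) * (((ρ₁ σ)⁻¹ : GL n B) : Matrix n n B) = 1 := by
    rw [← Units.val_mul, mul_inv_cancel, Units.val_one]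
  rw [e, hPP, sub_self, zero_add, mul_one, kerMatrix_mul_kerMatrix hI hX hσX, sub_zero]

/-! ## 4. The parabolic refinement: conjugating a lift into `P_b` -/

section Parabolic

variable {α : Type*} [LinearOrder α] (b : n → α)
  (hsP : ∀ g ∈ parabolicGL b A, s g ∈ parabolicGL b B) (hρP : ∀ σ, ρ σ ∈ parabolicGL b A)

include hI hs h₁ in
/-- **Conjugating a lift into the parabolic.**  Let `ρ_P = ρ₁` be a `P_b(B)`-valued lift of the
`P_b(A)`-valued `ρ` and `ρ₂` any lift.  If the difference cocycle is `𝔭_b(I)`-valued up to a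
coboundary, `d(σ) = e(σ) + (X − σ·X)` with `e(σ) ∈ 𝔭_b(I)` and `X ∈ M_n(I)`, then
`(1 + X)⁻¹ ρ₂(σ) (1 + X) = (1 + e(σ)) ρ_P(σ) ∈ P_b(B)` for all `σ`: the lift `ρ₂` is conjugate,
by an element of `ker(GL_n(B) → GL_n(A))`, to a `P_b(B)`-valued lift.  (So `ρ₂` satisfies the
parabolic condition up to strict equivalence iff its class relative to `ρ_P` lies in the image of
`H¹(G, 𝔭_b ⊗ I) → H¹(G, ad ⊗ I)`.) [cite: Mazur1989Deforming, §1.7] [cite: Bockle2007Presentations, Theorem 5.2] -/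
theorem conj_mem_parabolicGL_of_liftDiff_eq (hρ₁P : ∀ σ, ρ₁ σ ∈ parabolicGL b B)
    (e : G → Matrix n n B) (he : ∀ σ, e σ ∈ kerParabolic b φ)
    (X : Matrix n n B) (hX : X ∈ kerMatrix φ)
    (hd : ∀ σ, liftDiff ρ₁ ρ₂ σ =
      e σ + (X - (s (ρ σ) : Matrix n n B) * X * ((s (ρ σ))⁻¹ : GL n B))) (σ : G) :
    (unitOfKer hI X hX)⁻¹ * ρ₂ σ * unitOfKer hI X hX ∈ parabolicGL b B := by
  rw [mem_parabolicGL_iff, Units.val_mul, Units.val_mul, val_unitOfKer, val_unitOfKer_inv,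
    coe_eq_one_add_liftDiff_mul ρ₁ ρ₂ σ, hd σ,
    ← conj_eq_of_map_eq hI (ρ₁ σ) (s (ρ σ)) (by rw [h₁, hs]) hX]
  -- abbreviations
  set P : Matrix n n B := (ρ₁ σ : Matrix n n B) with hPdef
  set Q : Matrix n n B := (((ρ₁ σ)⁻¹ : GL n B) : Matrix n n B) with hQdef
  have hPQ : P * Q = 1 := by rw [hPdef, hQdef, ← Units.val_mul, mul_inv_cancel, Units.val_one]
  have heP : e σ ∈ kerMatrix φ := (he σ).1
  have hY : P * X * Q ∈ kerMatrix φ := mul_mem_kerMatrix_right _ (mul_mem_kerMatrix_left _ hX)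
  -- the vanishing products of kernel matrices
  have z1 : X * e σ = 0 := kerMatrix_mul_kerMatrix hI hX heP
  have z2 : X * X = 0 := kerMatrix_mul_kerMatrix hI hX hX
  have z3 : X * (P * X * Q) = 0 := kerMatrix_mul_kerMatrix hI hX hY
  have z4 : e σ * P * X = 0 := kerMatrix_mul_kerMatrix hI (mul_mem_kerMatrix_right _ heP) hX
  have z5 : P * X * X = 0 := by rw [mul_assoc, z2, mul_zero]
  have z6 : P * X * Q * P * X = 0 :=
    kerMatrix_mul_kerMatrix hI (mul_mem_kerMatrix_right _ hY) hX
  have key : (1 - X) * ((1 + (e σ + (X - P * X * Q))) * P) * (1 + X) = (1 + e σ) * P := by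
    have ex : (1 - X) * ((1 + (e σ + (X - P * X * Q))) * P) * (1 + X) =
        P + P * X + e σ * P + e σ * P * X + X * P - X * P + X * P * X - X * P * X
          - P * X * (Q * P) - P * X * (Q * P) * X
          - X * e σ * P - X * e σ * P * X - X * X * P - X * X * P * X
          + X * (P * X * Q) * P + X * (P * X * Q) * P * X := by
      noncomm_ring
    rw [ex, z1, z3, z4, z2]
    have hQP : Q * P = 1 := by rw [hPdef, hQdef, ← Units.val_mul, inv_mul_cancel, Units.val_one]
    rw [hQP, mul_one, z5]
    noncomm_ring
  rw [key]
  exact (blockTriangular_one.add (he σ).2).mul (hρ₁P σ)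

end Parabolic

end LiftingObstruction

end Literature.NumberTheory.GaloisRepresentations
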